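import Summits.BirchSwinnertonDyer.BirchSwinnertonDyer.Theorems.PrintCf2RubinValueTwoEllipticUnitsLocalRelation
import Literature.NumberTheory.EllipticCurves.PAdicTwoVariableRelNormCoherentUnitsOfGlobal
import HarnessLib

/-!
# The TWO-VARIABLE elliptic units `e(𝔞) = (Θ(1; 𝔤v̄^{i+1}v^{k+1}, 𝔞))_{i,k}` at one prime above `v`: a baseNorm-coherent family of
# `𝒰(E_i·K_π^∞)`, its principal projection `⟨e(𝔞)⟩ ∈ principalCoherentFamilies` (the domain of the two-variable Coleman map), and
# THE PRODUCT RULE `σ̃_𝔞·⟨e(𝔠)⟩ · ⟨e(𝔞)⟩^{N𝔠} = ⟨e(𝔞𝔠)⟩` for local lifts `σ̃_𝔞` of the Artin symbols (de Shalit II.2.4 (ii), II.4.14, III.1)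

Cell `bsd-print-cf2`, width seat `bsd-line-cf2c-w7` g15, route C `PrintCf2RubinValueTwo`, crux of record stmt-BirchSwinnertonDyer-24033
`TwoVariableMainConjAtSplitTwoQuad` (23720 nominal), BRICK §4(c); `--supports` the crux as a helper.  THEOREMS + two definitions by
composition; CONDITIONAL on the published named facts `DeShalit1987.prop24_ii_galoisAction` (II.2.4 (ii)), `prop24_iii_unit` (II.2.4 (iii)),
`prop25_i_normRelation` (II.2.5 (i)), `prop24_i_mem_rayClassField` (II.2.4 (i)) where stated — carried as hypotheses, never asserted.
Theses-free.  BSD is not proved by any of this.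

INPUT (i) + (ii)(R) of the capstone `ColemanCoinvariantArtin.charIdeal_coinvariants_colemanImage_closure_eq_span_of_mul_rule` (S26, g14):
principal coherent families `β_c ∈ principalCoherentFamilies hπ E hmono` indexed by ideals, with the product rule for local Galois elements.
The one-variable file `PrintCf2RubinValueTwoEllipticUnitsLocalTower` built `e(𝔞) = (Θ(1; 𝔪v^{k+1}, 𝔞))_k ∈ 𝒰_𝔓` for ONE modulus `𝔪`;
de Shalit's two-variable tower (II.4.14, III.1.1) has moduli `𝔪_i = 𝔤v̄^{i+1}` growing in the UNRAMIFIED-at-`v` direction.  THIS file: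

* §1 bookkeeping of the moduli `𝔤v'^{i+1}` (`v' ≠ v`, e.g. `v' = v̄`): non-zero, proper, antitone, prime to `v`, `w = 1`, coprimality;
* §2 `exists_forall₂_isThetaValueOne` — the two-variable theta family `x_{i,k} ∈ K(𝔤v'^{i+1}v^{k+1})`, `ι̂ x_{i,k} = Θ(1; 𝔤v'^{i+1}v^{k+1}, 𝔞)`
  EXISTS (GIVEN II.2.4 (i) and one period lattice `ι(𝔤)`); ★ `coe_towerNorm₂_eq_of_isThetaValueOne` — norm-coherence in the `v'`-direction
  `N_{K(𝔤v'^{i+2}v^{k+1})/K(𝔤v'^{i+1}v^{k+1})} x_{i+1,k} = x_{i,k}` (GIVEN II.2.5 (i), `v' ∣ 𝔤v'^{i+1}v^{k+1}`);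
* §3 ★★ `ellipticUnitsLocal₂` — **`e(𝔞) := ofGlobal₂ x ∈ coherentFamilies hπ E hmono`** for a local unramified tower `E_i ⊇ K(𝔤v'^{i+1})_𝔓`
  with inert steps (`ellipticUnitsLocal₂_mem_coherentFamilies`); `coe_val_ellipticUnitsLocal₂`, `ellipticUnitsLocal₂_congr`;
* §4 ★★★ **THE PRODUCT RULE** `galAct_ellipticUnitsLocal₂_mul_pow` — for `σ̃ ∈ Γ_{K_v}` restricting to the Artin symbol
  `(𝔞, K(𝔤v'^{i+1}v^{k+1})/K)` at every level, `σ̃·e(𝔠) · e(𝔞)^{N𝔠} = e(𝔞𝔠)` (II.2.4 (ii) transported: the local Galois action is the global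
  one).  The sequel `PrintCf2RubinValueTwoEllipticUnitsPrincipalTwo` applies the principal projection and the unramified offset
  (`⟨e(𝔞)⟩ ∈ principalCoherentFamilies`, the `hrule` shape of the capstone).

What remains for the capstone (not here): the index set of ideals whose Artin symbol lies in the decomposition group (existence of `σ̃_𝔞`),
the layer-approximation (Artin surjectivity + density), `a₁`/`a₂`, and `L_ε ≠ 0`.

## References
* [deShalit1987] E. de Shalit, *Iwasawa theory of elliptic curves with complex multiplication* (1987), II.2.4 (i)–(iii), II.2.5 (i) (p. 44–48),
  II.4.5 (12)–(13) (p. 58), II.4.12 (p. 66), II.4.14 Step 1 (p. 71), III.1.1–1.3 (p. 88–90, 101).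
* [Kato2004Asterisque] K. Kato, Astérisque 295 (2004), §15.3 (15.3.1), §15.5 (p. 252–253).
* [SerreLocalFields1979] J.-P. Serre, *Local Fields* (1979), Ch. II §4 Prop. 8.
-/

-- the summit namespace `Summit.BirchSwinnertonDyer.BirchSwinnertonDyer` repeats the problem name by design (D-0017)
set_option linter.dupNamespace false
set_option autoImplicit false

noncomputable section

open scoped Classical
open scoped NumberField
open Field IsDedekindDomain IsDedekindDomain.HeightOneSpectrum ValuativeRel
open Literature.NumberTheory.NumberFields
open Literature.NumberTheory.GaloisRepresentations Literature.NumberTheory.GaloisRepresentations.IsNonarchimedeanLocalField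
  Literature.NumberTheory.GaloisRepresentations.LubinTate Literature.NumberTheory.GaloisRepresentations.ArtinLocalGlobal
open Literature.NumberTheory.EllipticCurves
open Literature.NumberTheory.ComplexMultiplication.EllipticUnits
open Literature.NumberTheory.LFunctions.AbelianDensity (artinSymbol)
open Summit.BirchSwinnertonDyer.BirchSwinnertonDyer.Theorems.PrintCf2.LeopoldtAtV
open Summit.BirchSwinnertonDyer.BirchSwinnertonDyer.Theorems.PrintCf2.KatoThetaNorm
open Summit.BirchSwinnertonDyer.BirchSwinnertonDyer.Theorems.PrintCf2.EllipticUnitsLocal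

namespace Summit.BirchSwinnertonDyer.BirchSwinnertonDyer.Theorems.PrintCf2.EllipticUnitsLocal₂

variable {K : Type} [Field K] [NumberField K] {𝔤 : Ideal (𝓞 K)} {v v' : HeightOneSpectrum (𝓞 K)}

attribute [local instance] ltNormUniformSpace ltNormIsUniformAddGroup rk1 nF nE fintypeResidueField

/-! ## §1. The moduli `𝔤·v'^{i+1}` -/

omit [NumberField K] in
/-- `𝔤v'^{i+1} ≠ 0`. [cite: deShalit1987, II.4.14 Step 1 (p. 71)] -/
theorem moduli_ne_bot (h𝔤0 : 𝔤 ≠ ⊥) (v' : HeightOneSpectrum (𝓞 K)) : ∀ i : ℕ, 𝔤 * v'.asIdeal ^ (i + 1) ≠ ⊥ :=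
  fun i ↦ mul_pow_succ_ne_bot h𝔤0 v' i

omit [NumberField K] in
/-- `𝔤v'^{i+2} ≤ 𝔤v'^{i+1}` (antitone moduli). [cite: deShalit1987, II.4.14 Step 1 (p. 71)] -/
theorem moduli_anti (𝔤 : Ideal (𝓞 K)) (v' : HeightOneSpectrum (𝓞 K)) : ∀ i : ℕ, 𝔤 * v'.asIdeal ^ (i + 1 + 1) ≤ 𝔤 * v'.asIdeal ^ (i + 1) :=
  fun _ ↦ Ideal.mul_mono_right (Ideal.pow_le_pow_right (Nat.le_succ _))

/-- `v ∤ 𝔤v'^{i+1}` for `v ∤ 𝔤`, `v' ≠ v`. [cite: deShalit1987, II.4.14 Step 1 (p. 71)] -/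
theorem not_moduli_le (hv : ¬ 𝔤 ≤ v.asIdeal) (hvv' : v' ≠ v) : ∀ i : ℕ, ¬ 𝔤 * v'.asIdeal ^ (i + 1) ≤ v.asIdeal := by
  intro i h
  rcases (v.isPrime.mul_le).mp h with h1 | h2
  · exact hv h1
  · exact hvv' (HeightOneSpectrum.ext ((v'.isMaximal.eq_of_le v.isPrime.ne_top ((Ideal.IsPrime.pow_le_iff (hP := v.isPrime)
      (Nat.succ_ne_zero i)).mp h2))))

omit [NumberField K] in
/-- `w_{𝔤v'^{i+1}} = 1` from `w_{𝔤v'} = 1`. [cite: deShalit1987, II.1.9 (p. 43)] -/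
theorem hw_moduli (hw : ∀ u : (𝓞 K)ˣ, (u : 𝓞 K) - 1 ∈ 𝔤 * v'.asIdeal → u = 1) :
    ∀ i : ℕ, ∀ u : (𝓞 K)ˣ, (u : 𝓞 K) - 1 ∈ 𝔤 * v'.asIdeal ^ (i + 1) → u = 1 :=
  fun i u hu ↦ hw u (Ideal.mul_mono_right (by rw [pow_succ]; exact Ideal.mul_le_left) hu)

omit [NumberField K] in
/-- `𝔞` prime to `𝔤·v·v'` is prime to `𝔤v'^{i+1}·v`. [cite: deShalit1987, II.2.4 Proposition] -/
theorem isCoprime_moduli_mul {𝔞 : Ideal (𝓞 K)} (h𝔞c : IsCoprime 𝔞 (𝔤 * v.asIdeal * v'.asIdeal)) (i : ℕ) :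
    IsCoprime 𝔞 (𝔤 * v'.asIdeal ^ (i + 1) * v.asIdeal) :=
  ((h𝔞c.of_mul_right_left.of_mul_right_left).mul_right (h𝔞c.of_mul_right_right.pow_right)).mul_right
    h𝔞c.of_mul_right_left.of_mul_right_right

omit [NumberField K] in
/-- The two-variable modulus rearranged: `𝔤v'^{i+1}v^{k+1}·v' = 𝔤v'^{i+2}v^{k+1}`. [cite: deShalit1987, II.4.14 Step 1 (p. 71)] -/
theorem moduli_mul_pow_mul (𝔤 : Ideal (𝓞 K)) (v v' : HeightOneSpectrum (𝓞 K)) (i k : ℕ) :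
    𝔤 * v'.asIdeal ^ (i + 1) * v.asIdeal ^ (k + 1) * v'.asIdeal = 𝔤 * v'.asIdeal ^ (i + 1 + 1) * v.asIdeal ^ (k + 1) := by
  rw [mul_assoc (𝔤 * v'.asIdeal ^ (i + 1)), mul_comm (v.asIdeal ^ (k + 1)), ← mul_assoc, mul_assoc 𝔤, ← pow_succ]

/-! ## §2. The two-variable theta family: existence and norm-coherence in the `v'`-direction -/

/-- ★ **The two-variable theta family exists**: given II.2.4 (i) and one period lattice `ι(𝔤)`, for all `i, k` there is
`x_{i,k} ∈ K(𝔤v'^{i+1}v^{k+1})` with `ι̂ x_{i,k} = Θ(1; 𝔤v'^{i+1}v^{k+1}, 𝔞)`. [cite: deShalit1987, II.2.4 Proposition (i), II.4.14 (p. 71)]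
[cite: Kato2004Asterisque, §15.3 (15.3.1) (p. 252)] -/
theorem exists_forall₂_isThetaValueOne (h24i : DeShalit1987.prop24_i_mem_rayClassField) (hK : IsImaginaryQuadratic K) (ι : K →+* ℂ)
    (h𝔤0 : 𝔤 ≠ ⊥) (v v' : HeightOneSpectrum (𝓞 K)) {𝔞 : Ideal (𝓞 K)} (h𝔞0 : 𝔞 ≠ ⊥) (h𝔞c : IsCoprime 𝔞 (𝔤 * v.asIdeal * v'.asIdeal))
    {L₀ : PeriodPair} (hL₀ : ∀ z : ℂ, z ∈ L₀.lattice ↔ ∃ a ∈ 𝔤, z = ι (a : K)) :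
    ∃ x : ∀ i k : ℕ, rayClassField K (𝔤 * v'.asIdeal ^ (i + 1) * v.asIdeal ^ (k + 1)),
      ∀ i k : ℕ, IsThetaValueOne ι (𝔤 * v'.asIdeal ^ (i + 1) * v.asIdeal ^ (k + 1)) 𝔞
        (algClosureEmb ι ((x i k : rayClassField K (𝔤 * v'.asIdeal ^ (i + 1) * v.asIdeal ^ (k + 1))) : AlgebraicClosure K)) := by
  have key : ∀ i : ℕ, ∃ x : ∀ k : ℕ, rayClassField K (𝔤 * v'.asIdeal ^ (i + 1) * v.asIdeal ^ (k + 1)),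
      ∀ k, IsThetaValueOne ι (𝔤 * v'.asIdeal ^ (i + 1) * v.asIdeal ^ (k + 1)) 𝔞
        (algClosureEmb ι ((x k : rayClassField K (𝔤 * v'.asIdeal ^ (i + 1) * v.asIdeal ^ (k + 1))) : AlgebraicClosure K)) := by
    intro i
    -- a period pair with lattice `ι(𝔤v'^{i+1})`
    obtain ⟨c, hc, hc0⟩ := Submodule.exists_mem_ne_zero_of_ne_bot (pow_ne_zero (i + 1) v'.ne_bot)
    obtain ⟨P, hP⟩ := exists_periodPair_mem_iff_of_le hL₀ (Ideal.mul_le_right (I := 𝔤) (J := v'.asIdeal ^ (i + 1))) hc0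
      (fun a ha ↦ by rw [mul_comm 𝔤]; exact Ideal.mul_mem_mul hc ha)
    exact exists_forall_isThetaValueOne h24i hK ι (moduli_ne_bot h𝔤0 v' i) v h𝔞0 (isCoprime_moduli_mul h𝔞c i) hP
  choose x hx using key
  exact ⟨x, hx⟩

/-- ★ **NORM-COHERENCE IN THE `v'`-DIRECTION** (de Shalit II.2.5 (i) with `𝔩 = v' ∣ 𝔤v'^{i+1}v^{k+1}`): for `y ∈ K(𝔤v'^{i+1}v^{k+1})` under
`Θ(1; 𝔤v'^{i+1}v^{k+1}, 𝔞)` and `z ∈ K(𝔤v'^{i+2}v^{k+1})` under `Θ(1; 𝔤v'^{i+2}v^{k+1}, 𝔞)`, `N(z) = y` in `K̄` (`Algebra.norm` for the inclusion).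
[cite: deShalit1987, II.2.5 Proposition (i), II.4.14 Step 1 (p. 71)] [cite: Kato2004Asterisque, §15.5 (p. 253)] -/
theorem coe_towerNorm₂_eq_of_isThetaValueOne (h25 : DeShalit1987.prop25_i_normRelation) (hK : IsImaginaryQuadratic K) (ι : K →+* ℂ)
    (h𝔤0 : 𝔤 ≠ ⊥) (hw : ∀ u : (𝓞 K)ˣ, (u : 𝓞 K) - 1 ∈ 𝔤 * v'.asIdeal → u = 1) (v : HeightOneSpectrum (𝓞 K))
    {𝔞 : Ideal (𝓞 K)} (h𝔞0 : 𝔞 ≠ ⊥) (h𝔞c : IsCoprime 𝔞 (𝔤 * v.asIdeal * v'.asIdeal)) (i k : ℕ)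
    {y : AlgebraicClosure K} (hy : y ∈ rayClassField K (𝔤 * v'.asIdeal ^ (i + 1) * v.asIdeal ^ (k + 1)))
    (hyΘ : IsThetaValueOne ι (𝔤 * v'.asIdeal ^ (i + 1) * v.asIdeal ^ (k + 1)) 𝔞 (algClosureEmb ι y))
    (z : rayClassField K (𝔤 * v'.asIdeal ^ (i + 1 + 1) * v.asIdeal ^ (k + 1)))
    (hzΘ : IsThetaValueOne ι (𝔤 * v'.asIdeal ^ (i + 1 + 1) * v.asIdeal ^ (k + 1)) 𝔞 (algClosureEmb ι (z : AlgebraicClosure K))) :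
    ((@Algebra.norm (rayClassField K (𝔤 * v'.asIdeal ^ (i + 1) * v.asIdeal ^ (k + 1)))
        (rayClassField K (𝔤 * v'.asIdeal ^ (i + 1 + 1) * v.asIdeal ^ (k + 1))) _ _
        (towerAlgebra (rayClassField_le_of_le (mul_ne_zero (moduli_ne_bot h𝔤0 v' (i + 1)) (pow_ne_zero _ v.ne_bot))
          (Ideal.mul_mono_left (moduli_anti 𝔤 v' i)))) z :
      rayClassField K (𝔤 * v'.asIdeal ^ (i + 1) * v.asIdeal ^ (k + 1))) : AlgebraicClosure K) = y := by
  obtain ⟨L, La, S, hL, hLa, hS, hyθ⟩ := hyΘ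
  obtain ⟨L', La', S', hL', hLa', hS', hzθ⟩ := hzΘ
  have hle : rayClassField K (𝔤 * v'.asIdeal ^ (i + 1) * v.asIdeal ^ (k + 1)) ≤
      rayClassField K (𝔤 * v'.asIdeal ^ (i + 1 + 1) * v.asIdeal ^ (k + 1)) :=
    rayClassField_le_of_le (mul_ne_zero (moduli_ne_bot h𝔤0 v' (i + 1)) (pow_ne_zero _ v.ne_bot)) (Ideal.mul_mono_left (moduli_anti 𝔤 v' i))
  -- `normOver` at the rearranged modulus `𝔤v'^{i+1}v^{k+1}·v'`
  have hz' : (z : AlgebraicClosure K) ∈ rayClassField K (𝔤 * v'.asIdeal ^ (i + 1) * v.asIdeal ^ (k + 1) * v'.asIdeal) := by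
    rw [moduli_mul_pow_mul]; exact z.2
  have hL'' : ∀ w : ℂ, w ∈ L'.lattice ↔ ∃ a ∈ 𝔤 * v'.asIdeal ^ (i + 1) * v.asIdeal ^ (k + 1) * v'.asIdeal, w = ι (a : K) := by
    rw [moduli_mul_pow_mul]; exact hL'
  have h𝔤' : 𝔤 * v'.asIdeal ^ (i + 1) * v.asIdeal ^ (k + 1) ≠ ⊥ := mul_ne_zero (moduli_ne_bot h𝔤0 v' i) (pow_ne_zero _ v.ne_bot)
  have h𝔤'1 : 𝔤 * v'.asIdeal ^ (i + 1) * v.asIdeal ^ (k + 1) ≠ ⊤ := mul_pow_succ_ne_top _ v k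
  have hrig : UnitsInjectiveMod (𝔤 * v'.asIdeal ^ (i + 1) * v.asIdeal ^ (k + 1)) :=
    (unitsInjectiveMod_of_forall hw).anti
      ((Ideal.mul_le_right).trans (Ideal.mul_mono_right (by rw [pow_succ]; exact Ideal.mul_le_left)))
  have hdiv : v'.asIdeal ∣ 𝔤 * v'.asIdeal ^ (i + 1) * v.asIdeal ^ (k + 1) :=
    ((dvd_pow_self v'.asIdeal (Nat.succ_ne_zero i)).mul_left 𝔤).mul_right _
  have h𝔞c' : IsCoprime 𝔞 (𝔤 * v'.asIdeal ^ (i + 1) * v.asIdeal ^ (k + 1) * v'.asIdeal) := by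
    rw [moduli_mul_pow_mul]; exact isCoprime_mul_pow_succ (isCoprime_moduli_mul h𝔞c (i + 1)) k
  have hstep := algClosureEmb_normOver_step h25 hK ι v' h𝔤' h𝔤'1 hrig hdiv h𝔞0 h𝔞c' hL hLa hS hL'' hLa' hS' hy hyθ hz' hzθ
  rw [coe_normOver_congr (congrArg (rayClassField K) (moduli_mul_pow_mul 𝔤 v v' i k)) rfl hz' z.2, ← hyθ] at hstep
  -- `Algebra.norm = normOver`
  have h := algebraMap_norm_eq_normOver hle z
  have h' := congrArg (fun w : rayClassField K (𝔤 * v'.asIdeal ^ (i + 1 + 1) * v.asIdeal ^ (k + 1)) ↦ (w : AlgebraicClosure K)) h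
  change ((IntermediateField.inclusion hle _ : rayClassField K (𝔤 * v'.asIdeal ^ (i + 1 + 1) * v.asIdeal ^ (k + 1))) :
    AlgebraicClosure K) = _ at h'
  rw [IntermediateField.coe_inclusion] at h'
  rw [h']
  exact (algClosureEmb ι).injective hstep

/-! ## §3. `e(𝔞) ∈ 𝒰_∞` and `⟨e(𝔞)⟩ ∈ 𝒰¹_∞` -/

section Local

variable [NumberField.IsTotallyComplex K]
  (h24iii : DeShalit1987.prop24_iii_unit) (h25 : DeShalit1987.prop25_i_normRelation) (hK : IsImaginaryQuadratic K) (ι : K →+* ℂ)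
  (h𝔤0 : 𝔤 ≠ ⊥) (hv : ¬ 𝔤 ≤ v.asIdeal) (hvv' : v' ≠ v) (hw : ∀ u : (𝓞 K)ˣ, (u : 𝓞 K) - 1 ∈ 𝔤 * v'.asIdeal → u = 1)
  {π : 𝒪[v.adicCompletion K]} (hπ : (valuation (v.adicCompletion K)).IsUniformizer (π : v.adicCompletion K))
  {α : ℕ → 𝓞 K} (hα0 : ∀ i, α i ≠ 0) (hα𝔪 : ∀ i, α i - 1 ∈ 𝔤 * v'.asIdeal ^ (i + 1))
  (hαw : ∀ i, ∀ w : HeightOneSpectrum (𝓞 K), w ≠ v → α i ∉ w.asIdeal)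
  {f : ℕ → ℕ} (hαπ : ∀ i, ((α i : K) : v.adicCompletion K) = (π : v.adicCompletion K) ^ f i)
  (E : ℕ → IntermediateField (v.adicCompletion K) (AlgebraicClosure (v.adicCompletion K)))
  [∀ i, FiniteDimensional (v.adicCompletion K) (E i)] [∀ i, IsGalois (v.adicCompletion K) (E i)]
  (hmono : Monotone E) (hE : ∀ i, E i ≤ maxUnramified (v.adicCompletion K))
  (hdegE : ∀ i, ∀ w : WeilGroup (v.adicCompletion K),
    WeilGroup.toAbsGalois (v.adicCompletion K) w ∈ (E i).fixingSubgroup → (f i : ℤ) ∣ WeilGroup.deg w)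
  {𝔞 : Ideal (𝓞 K)} (h𝔞0 : 𝔞 ≠ ⊥) (h𝔞c : IsCoprime 𝔞 (𝔤 * v.asIdeal * v'.asIdeal))

include h24iii h25 hK hvv' h𝔞0 h𝔞c in
/-- ★★ **THE TWO-VARIABLE ELLIPTIC UNITS `e(𝔞) = (Θ(1; 𝔤v'^{i+1}v^{k+1}, 𝔞))_{i,k}` as a family of `𝒰(E_i·K_π^∞)`** (de Shalit II.4.14 /
III.1.1, one prime above `v`): `ofGlobal₂` of any theta family — units by II.2.4 (iii), norm-coherent in `k` by II.2.5 (i).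
[cite: deShalit1987, II.4.5 (12), II.4.14 Step 1 (p. 71), III.1.1 (p. 88), II.2.4 (iii), II.2.5 (i)] -/
def ellipticUnitsLocal₂ (x : ∀ i k : ℕ, rayClassField K (𝔤 * v'.asIdeal ^ (i + 1) * v.asIdeal ^ (k + 1)))
    (hx : ∀ i k : ℕ, IsThetaValueOne ι (𝔤 * v'.asIdeal ^ (i + 1) * v.asIdeal ^ (k + 1)) 𝔞
      (algClosureEmb ι ((x i k : rayClassField K (𝔤 * v'.asIdeal ^ (i + 1) * v.asIdeal ^ (k + 1))) : AlgebraicClosure K)))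
    (i : ℕ) : RelNormCoherentUnits hπ (E i) :=
  RelNormCoherentUnits.ofGlobal₂ hπ (moduli_ne_bot h𝔤0 v') (not_moduli_le hv hvv') (hw_moduli hw) hα0 hα𝔪 hαw hαπ E hE hdegE x
    (fun i k ↦ ne_zero_of_isThetaValueOne ι (mul_pow_succ_ne_top _ v k) (isCoprime_mul_pow_succ (isCoprime_moduli_mul h𝔞c i) k) (hx i k))
    (fun i k ↦ (isIntegral_and_inv_of_isThetaValueOne h24iii hK ι (moduli_ne_bot h𝔤0 v' i) (mul_pow_succ_ne_top 𝔤 v' i)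
      (not_moduli_le hv hvv' i) h𝔞0 (isCoprime_moduli_mul h𝔞c i) k (hx i k)).1)
    (fun i k ↦ (isIntegral_and_inv_of_isThetaValueOne h24iii hK ι (moduli_ne_bot h𝔤0 v' i) (mul_pow_succ_ne_top 𝔤 v' i)
      (not_moduli_le hv hvv' i) h𝔞0 (isCoprime_moduli_mul h𝔞c i) k (hx i k)).2)
    (fun i _ _ hnk ↦ coe_towerNorm_eq_of_isThetaValueOne h25 hK ι (moduli_ne_bot h𝔤0 v' i) (unitsInjectiveMod_of_forall (hw_moduli hw i)) v
      h𝔞0 (isCoprime_moduli_mul h𝔞c i) (x i) (hx i) hnk) i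

/-- **Components**: `e(𝔞)_{i,k} = ι_v(x_{i,k})`, `ι̂ x_{i,k} = Θ(1; 𝔤v'^{i+1}v^{k+1}, 𝔞)`. [cite: deShalit1987, II.4.5 (12) (p. 58)] -/
theorem coe_val_ellipticUnitsLocal₂ (x : ∀ i k : ℕ, rayClassField K (𝔤 * v'.asIdeal ^ (i + 1) * v.asIdeal ^ (k + 1)))
    (hx : ∀ i k : ℕ, IsThetaValueOne ι (𝔤 * v'.asIdeal ^ (i + 1) * v.asIdeal ^ (k + 1)) 𝔞
      (algClosureEmb ι ((x i k : rayClassField K (𝔤 * v'.asIdeal ^ (i + 1) * v.asIdeal ^ (k + 1))) : AlgebraicClosure K))) (i k : ℕ) :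
    ((((ellipticUnitsLocal₂ h24iii h25 hK ι h𝔤0 hv hvv' hw hπ hα0 hα𝔪 hαw hαπ E hE hdegE h𝔞0 h𝔞c x hx i).val k :
        unitBall (E i ⊔ ltField π k : IntermediateField (v.adicCompletion K) (AlgebraicClosure (v.adicCompletion K)))) :
        (E i ⊔ ltField π k : IntermediateField (v.adicCompletion K) (AlgebraicClosure (v.adicCompletion K)))) :
      AlgebraicClosure (v.adicCompletion K)) =
      absClosureEmbedding K (v.adicCompletion K) ((x i k : rayClassField K (𝔤 * v'.asIdeal ^ (i + 1) * v.asIdeal ^ (k + 1))) :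
        AlgebraicClosure K) := rfl

/-- **Independence of the representatives**: two theta families with the same values in `K̄` give the same `e(𝔞)`.
[cite: deShalit1987, II.4.5 (12) (p. 58)] -/
theorem ellipticUnitsLocal₂_congr (x x' : ∀ i k : ℕ, rayClassField K (𝔤 * v'.asIdeal ^ (i + 1) * v.asIdeal ^ (k + 1)))
    (hx : ∀ i k : ℕ, IsThetaValueOne ι (𝔤 * v'.asIdeal ^ (i + 1) * v.asIdeal ^ (k + 1)) 𝔞
      (algClosureEmb ι ((x i k : rayClassField K (𝔤 * v'.asIdeal ^ (i + 1) * v.asIdeal ^ (k + 1))) : AlgebraicClosure K)))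
    (hx' : ∀ i k : ℕ, IsThetaValueOne ι (𝔤 * v'.asIdeal ^ (i + 1) * v.asIdeal ^ (k + 1)) 𝔞
      (algClosureEmb ι ((x' i k : rayClassField K (𝔤 * v'.asIdeal ^ (i + 1) * v.asIdeal ^ (k + 1))) : AlgebraicClosure K)))
    (h : ∀ i k : ℕ, ((x i k : rayClassField K (𝔤 * v'.asIdeal ^ (i + 1) * v.asIdeal ^ (k + 1))) : AlgebraicClosure K) = x' i k) (i : ℕ) :
    ellipticUnitsLocal₂ h24iii h25 hK ι h𝔤0 hv hvv' hw hπ hα0 hα𝔪 hαw hαπ E hE hdegE h𝔞0 h𝔞c x hx i =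
      ellipticUnitsLocal₂ h24iii h25 hK ι h𝔤0 hv hvv' hw hπ hα0 hα𝔪 hαw hαπ E hE hdegE h𝔞0 h𝔞c x' hx' i := by
  unfold ellipticUnitsLocal₂ RelNormCoherentUnits.ofGlobal₂
  exact ofGlobal_congr (moduli_ne_bot h𝔤0 v' i) (not_moduli_le hv hvv' i) (hw_moduli hw i) hπ (hα0 i) (hα𝔪 i) (hαw i) (hαπ i) (E i)
    (hE i) (hdegE i) (h i)

variable
  (hinert : ∀ i, ∀ τ : absoluteGaloisGroup (v.adicCompletion K),
    (∀ y ∈ rayClassField K (𝔤 * v'.asIdeal ^ (i + 1 + 1)),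
      τ • absClosureEmbedding K (v.adicCompletion K) y = absClosureEmbedding K (v.adicCompletion K) y) →
      τ ∈ (E (i + 1)).fixingSubgroup)
  (hcount : ∀ i k : ℕ, IntermediateField.relfinrank (rayClassField K (𝔤 * v'.asIdeal ^ (i + 1) * v.asIdeal ^ (k + 1)))
      (rayClassField K (𝔤 * v'.asIdeal ^ (i + 1 + 1) * v.asIdeal ^ (k + 1))) * Module.finrank (v.adicCompletion K) (E i) ≤
      Module.finrank (v.adicCompletion K) (E (i + 1)))

include hinert hcount in
/-- ★★ **`e(𝔞) ∈ coherentFamilies hπ E hmono`**: the two-variable elliptic units are baseNorm-coherent along the unramified tower — the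
`v'`-direction norm relation II.2.5 (i) (`coe_towerNorm₂_eq_of_isThetaValueOne`) read through `ofGlobal₂_baseNormCoherent` (global norms are
local norms in the inert unramified direction). [cite: deShalit1987, II.4.14 Step 1 (p. 71), III.1.1–1.3 (p. 88–90), II.2.5 (i)] -/
theorem ellipticUnitsLocal₂_mem_coherentFamilies (x : ∀ i k : ℕ, rayClassField K (𝔤 * v'.asIdeal ^ (i + 1) * v.asIdeal ^ (k + 1)))
    (hx : ∀ i k : ℕ, IsThetaValueOne ι (𝔤 * v'.asIdeal ^ (i + 1) * v.asIdeal ^ (k + 1)) 𝔞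
      (algClosureEmb ι ((x i k : rayClassField K (𝔤 * v'.asIdeal ^ (i + 1) * v.asIdeal ^ (k + 1))) : AlgebraicClosure K))) :
    (fun i ↦ ellipticUnitsLocal₂ h24iii h25 hK ι h𝔤0 hv hvv' hw hπ hα0 hα𝔪 hαw hαπ E hE hdegE h𝔞0 h𝔞c x hx i) ∈
      coherentFamilies hπ E hmono :=
  ofGlobal₂_mem_coherentFamilies hπ (moduli_ne_bot h𝔤0 v') (moduli_anti 𝔤 v') (not_moduli_le hv hvv') (hw_moduli hw) hα0 hα𝔪 hαw hαπ
    E hmono hE hdegE x _ _ _ _ hinert hcount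
    (fun i k ↦ coe_towerNorm₂_eq_of_isThetaValueOne h25 hK ι h𝔤0 hw v h𝔞0 h𝔞c i k (x i k).2 (hx i k) (x (i + 1) k) (hx (i + 1) k))

/-! ## §4. THE PRODUCT RULE (de Shalit II.2.4 (ii) in `𝒰_∞`) -/

omit [NumberField K] [NumberField.IsTotallyComplex K] in
/-- `((τ|_L) y : K̄) = τ • y`. [folklore] -/
private theorem coe_absRestrictNormalHom_apply₂ (L : IntermediateField K (AlgebraicClosure K)) [Normal K L]
    (τ : absoluteGaloisGroup K) (y : L) : ((absRestrictNormalHom L τ y : L) : AlgebraicClosure K) = τ • (y : AlgebraicClosure K) :=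
  AlgEquiv.restrictNormalHom_apply L _ y

section MulRule

attribute [local instance] RelNormCoherentUnits.instCommMonoid

variable (h24ii : DeShalit1987.prop24_ii_galoisAction)
  {𝔠 : Ideal (𝓞 K)} (h𝔠0 : 𝔠 ≠ ⊥) (h𝔠c : IsCoprime 𝔠 (𝔤 * v.asIdeal * v'.asIdeal))
  (h𝔞𝔠c : IsCoprime (𝔞 * 𝔠) (𝔤 * v.asIdeal * v'.asIdeal))

include h24ii in
/-- ★★★ **THE PRODUCT RULE for `e(𝔞)`, `e(𝔠)`, `e(𝔞𝔠)`** (de Shalit II.2.4 (ii) `σ_𝔞 e(𝔠)·e(𝔞)^{N𝔠} = e(𝔞𝔠)`, transported to the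
two-variable local families): for ANY `σ̃ ∈ Γ_{K_v}` whose restriction to every `K(𝔤v'^{i+1}v^{k+1})` is the Artin symbol of `𝔞`,
**`σ̃·e(𝔠) · e(𝔞)^{N𝔠} = e(𝔞𝔠)`** in `∏_i 𝒰(E_i·K_π^∞)` — componentwise `ι_v((𝔞, ·)x^𝔠_{i,k})·ι_v(x^𝔞_{i,k})^{N𝔠} = ι_v(x^{𝔞𝔠}_{i,k})`, the local
Galois action being the global one (`coe_val_galAct_ofGlobal₂`) and `Θ(1; 𝔤, 𝔞𝔠)` being well defined.
[cite: deShalit1987, II.2.4 Proposition (ii), II.4.12 (p. 66), II.4.14 (p. 71)] -/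
theorem galAct_ellipticUnitsLocal₂_mul_pow
    (xa : ∀ i k : ℕ, rayClassField K (𝔤 * v'.asIdeal ^ (i + 1) * v.asIdeal ^ (k + 1)))
    (hxa : ∀ i k : ℕ, IsThetaValueOne ι (𝔤 * v'.asIdeal ^ (i + 1) * v.asIdeal ^ (k + 1)) 𝔞
      (algClosureEmb ι ((xa i k : rayClassField K (𝔤 * v'.asIdeal ^ (i + 1) * v.asIdeal ^ (k + 1))) : AlgebraicClosure K)))
    (xc : ∀ i k : ℕ, rayClassField K (𝔤 * v'.asIdeal ^ (i + 1) * v.asIdeal ^ (k + 1)))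
    (hxc : ∀ i k : ℕ, IsThetaValueOne ι (𝔤 * v'.asIdeal ^ (i + 1) * v.asIdeal ^ (k + 1)) 𝔠
      (algClosureEmb ι ((xc i k : rayClassField K (𝔤 * v'.asIdeal ^ (i + 1) * v.asIdeal ^ (k + 1))) : AlgebraicClosure K)))
    (xac : ∀ i k : ℕ, rayClassField K (𝔤 * v'.asIdeal ^ (i + 1) * v.asIdeal ^ (k + 1)))
    (hxac : ∀ i k : ℕ, IsThetaValueOne ι (𝔤 * v'.asIdeal ^ (i + 1) * v.asIdeal ^ (k + 1)) (𝔞 * 𝔠)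
      (algClosureEmb ι ((xac i k : rayClassField K (𝔤 * v'.asIdeal ^ (i + 1) * v.asIdeal ^ (k + 1))) : AlgebraicClosure K)))
    (σ : absoluteGaloisGroup (v.adicCompletion K))
    (hσ : ∀ i k : ℕ, absRestrictNormalHom (rayClassField K (𝔤 * v'.asIdeal ^ (i + 1) * v.asIdeal ^ (k + 1)))
        (absGaloisRestrict K (v.adicCompletion K) σ) =
      artinSymbol (galFrob K (rayClassField K (𝔤 * v'.asIdeal ^ (i + 1) * v.asIdeal ^ (k + 1)))) 𝔞)
    (i : ℕ) :
    (ellipticUnitsLocal₂ h24iii h25 hK ι h𝔤0 hv hvv' hw hπ hα0 hα𝔪 hαw hαπ E hE hdegE h𝔠0 h𝔠c xc hxc i).galAct σ *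
        ellipticUnitsLocal₂ h24iii h25 hK ι h𝔤0 hv hvv' hw hπ hα0 hα𝔪 hαw hαπ E hE hdegE h𝔞0 h𝔞c xa hxa i ^ Ideal.absNorm 𝔠 =
      ellipticUnitsLocal₂ h24iii h25 hK ι h𝔤0 hv hvv' hw hπ hα0 hα𝔪 hαw hαπ E hE hdegE (mul_ne_zero h𝔞0 h𝔠0) h𝔞𝔠c xac hxac i := by
  refine RelNormCoherentUnits.ext fun k ↦ Subtype.ext (Subtype.ext ?_)
  rw [RelNormCoherentUnits.val_mul', RelNormCoherentUnits.val_pow, MulMemClass.coe_mul, MulMemClass.coe_mul, SubmonoidClass.coe_pow,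
    SubmonoidClass.coe_pow]
  unfold ellipticUnitsLocal₂
  rw [coe_val_galAct_ofGlobal₂, coe_val_ofGlobal₂, coe_val_ofGlobal₂, ← map_pow, ← map_mul]
  congr 1
  -- in `K̄`: `(𝔞, ·)x^𝔠 · (x^𝔞)^{N𝔠} = x^{𝔞𝔠}`
  have h1 : absGaloisRestrict K (v.adicCompletion K) σ •
      ((xc i k : rayClassField K (𝔤 * v'.asIdeal ^ (i + 1) * v.asIdeal ^ (k + 1))) : AlgebraicClosure K) =
      ((artinSymbol (galFrob K (rayClassField K (𝔤 * v'.asIdeal ^ (i + 1) * v.asIdeal ^ (k + 1)))) 𝔞 (xc i k) :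
        rayClassField K (𝔤 * v'.asIdeal ^ (i + 1) * v.asIdeal ^ (k + 1))) : AlgebraicClosure K) := by
    rw [← coe_absRestrictNormalHom_apply₂, hσ i k]
  rw [h1]
  apply (algClosureEmb ι).injective
  rw [map_mul, map_pow]
  have h𝔤'1 : 𝔤 * v'.asIdeal ^ (i + 1) * v.asIdeal ^ (k + 1) ≠ ⊤ := mul_pow_succ_ne_top _ v k
  have hΘ := isThetaValueOne_algClosureEmb_artin_mul_pow h24ii hK ι (mul_pow_succ_ne_bot (moduli_ne_bot h𝔤0 v' i) v k) h𝔤'1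
    h𝔠0 (isCoprime_mul_pow_succ (isCoprime_moduli_mul h𝔠c i) k) h𝔞0 (isCoprime_mul_pow_succ (isCoprime_moduli_mul h𝔞c i) k)
    (hxc i k) (hxa i k)
  rw [mul_comm 𝔠 𝔞] at hΘ
  exact isThetaValueOne_unique h𝔤'1 hΘ (hxac i k)

end MulRule

end Local

end Summit.BirchSwinnertonDyer.BirchSwinnertonDyer.Theorems.PrintCf2.EllipticUnitsLocal₂

end
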